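import Summits.QuantumFields.YangMills.Theorems.BalabanUVNodesN07PrintWindowDataSmall
import Summits.QuantumFields.YangMills.Theorems.BalabanUVNodesN07ChartTopBoxPlaquettesB
import HarnessLib

/-!
# N07 [B11] (= [15] = [Balaban1985Variational]) Sect. F — MODULE 69b″ (`…PrintWindowDataSmall` §2) AT PRINT's [II] (2.3) DATUM AND PRINT's (7) DATA: the letter `δ̂` on print's whole window `□̃`
# at a meeting, print-margin-clean datum of the run, from the (2.3) fibre `AgreeOnB (lamBondsSeq s.Ω k) (Ū U) W` and print's top-domain (7) `Sect2.DataSmall7LamTop` — SAME constant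
# `δ̂ = (1 + 2C_L)·δ_j` (S1c∕C2 of the (E1)∕(iii-b) work plan, director-ym №338∕№339; FLAG №16; LOCATE-HSEAM 5d3298b8d191f169; DOOR-LIST-E1 Tier C2)

Cell `pub-ymgap`, seat `pub-ymgap-dag-n07-e` g34 (FAN-OUT §N07 row s3; LANE OWNER of the K0 road chart side).  `--kind proof --supports stmt-QuantumFields-20541 --as helper` (K0⁷); count-neutral;
def-free; ONE theorem.  PRINT-DATUM TWIN of `…N07PrintWindowDataSmall.plaqSmallOn_printWindow_iter_of_data` (FLAG №16 ∕ LOCATE-HSEAM 5d3298b8d191f169); the (b)-instance stays landed and true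
on its own text; §1's geometry (`unitBox_subset_printWindowBox`, `exists_mem_box_within_of_mem_printWindowBox`) is datum-free and cited by name.  No displayed premise is deleted or weakened
except by RE-KEYING to print's objects: `AgreeOn (genSet s.Ω k)` ↦ `AgreeOnB (lamBondsSeq s.Ω k)` ([II] (2.3) «Λ_j = Ω_j^{(j)} ∖ Ω_{j+1}^{(j)} … for the sets of sites and the sets of bonds»,
p. 224; ruling (α): the DIFFERENCE of the bond sets — inward connectors belong to no `Λ_j`), `Sect2.DataSmall7PTop` ↦ §7′'s `Sect2.DataSmall7LamTop` (print's (7) p. 278 L20–33 on print's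
ranges `Sect2.lamPlaqs ∕ lamPlaqsTop`, (7) field `Sect2.mixedFieldB (lamBondsSeq …)`).  [15] = [Balaban1985Variational]; [3] = [Balaban1985Averaging]; [II] = [Balaban1984PropagatorsII];
[III] = [Balaban1988Convergent].

WHY ∕ HOW.  The proof is 69b″'s verbatim with the reader MODULE 69a₂ replaced by its print-datum twin `…ChartTopBoxPlaquettesB.plaqSmallOn_boxPlaqs_iter_succB`, which asks ONE more letter: block
saturation of `Ω_{m+2}` below the top (grid numerics, `blockSat_seqOfRecord` at level `m+2 ≤ k`) — supplied here next to the saturation of `Ω_{m+1}`.  Margin ∕ collar ∕ support clauses and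
the final `δ_m ≤ 2δ_{m+1}` step unchanged.

WHAT IS PROVED (sorry-free; no definition; axioms standard).  ★★★ `plaqSmallOn_printWindow_iter_of_dataB` — the letter `hV` of MODULE 62″ at the record, `δ̂ = (1 + 2C_L)·δ_j`, at print's datum.
HONEST SCOPE.  Count-neutral; the fibre, the data's (7), the ranges and the run's letters are HYPOTHESES (the twin token's ∕ the knit's own binders); nothing of [15]'s analysis asserted; K0⁷ ∕
K1⁹ NOT closed; N07 NOT discharged; counts unmoved (typed 28∕28 · discharged 8∕28); one finite 𝕋⁴ programme at fixed ε — the route closes the conditional finite-𝕋⁴ rung `BalabanLadder.UV` ONLY;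
the YM mass gap (Clay) is NOT proved by any of this; nothing continuum ∕ ℝ⁴ ∕ OS.  No `sorry`, no `def`, no `instance`, no `notation`.

References: [15] (7) p. 278 L20–33, (13) p. 280, (144) p. 300, (147) p. 301, (160) p. 303; [3] Prop. 1 (51) pp. 25–26; [II] (2.3) p. 224 L10–16; [III] p. 255, (2.2) p. 255, (2.10)–(2.11),
(2.13) p. 256.
-/

set_option autoImplicit false

noncomputable section
open scoped BigOperators Matrix.Norms.L2Operator

namespace Summit.QuantumFields.YangMills.BalabanUVNodes.N07PrintWindowDataSmallB

open Literature.MathematicalPhysics.QuantumFieldTheory.Balaban1983to89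
open Literature.MathematicalPhysics.QuantumFieldTheory.Balaban1983to89.Node00
open Literature.MathematicalPhysics.QuantumFieldTheory.Balaban1983to89.B15DeterminingSets
open Literature.MathematicalPhysics.QuantumFieldTheory.Balaban1983to89.B15DeterminingSetsB
open T4Continuum (T4Family)
open T4AxialGaugeSmallField (castSite boxPlaqs)
open B15Eq112TorusCover (cover)
open B14DomainGeom (Pt Within)
open B8Eq131Cubes (box bLo bHi tLo tHi tcube)
open B5Eq118OneStroke (iterBlockOf)
open ExpMeanLog (deltaSU)
open Summit.QuantumFields.YangMills.BalabanUVNodes.N07ChartTopBoxPlaquettesB (plaqSmallOn_boxPlaqs_iter_succB)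
open Summit.QuantumFields.YangMills.BalabanUVNodes.N07ChartTopBoxPlaquetteValues (mem_box_of_mem_unitBox)
open Summit.QuantumFields.YangMills.BalabanUVNodes.N07SplitClauseLevelRaisingMarginWide (wbox_two_mul_eq_tcube)
open Summit.QuantumFields.YangMills.BalabanUVNodes.N07ChartTopBoxDataSmall (two_mul_L_lt_sitesPerDir)
open Summit.QuantumFields.YangMills.BalabanUVNodes.N07RecordDomainsAdm22 (blockSat_seqOfRecord)
open Summit.QuantumFields.YangMills.BalabanUVNodes.N07PrintWindowDataSmall (unitBox_subset_printWindowBox exists_mem_box_within_of_mem_printWindowBox)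

/-! ## §1  The letter `δ̂` at a meeting, print-margin-clean datum of the run — print datum -/

section Record

variable (F : T4Family) (N : ℕ) [NeZero N]

/-- ★★★ **«(7) FOR V» ON PRINT's WHOLE WINDOW `□̃`, AT THE RECORD, AT PRINT's [II] (2.3) DATUM AND PRINT's (7) DATA** — print-datum twin of `plaqSmallOn_printWindow_iter_of_data` (FLAG №16 ∕
LOCATE-HSEAM 5d3298b8d191f169; the (b)-instance stays landed and true on its own text): MODULE 62″'s displayed letter `hV` with the SAME `δ̂ = (1 + 2C_L)·δ_j`, from the (2.3) fibre
`AgreeOnB (lamBondsSeq s.Ω k) (Ū U) W` and print's top-domain (7) `Sect2.DataSmall7LamTop` (§7′) in place of `AgreeOn (genSet s.Ω k)` ∕ `Sect2.DataSmall7PTop`; every other binder identical: for a separated run `s` (`Sect2.SeqSeparated ν.M₁ s`) with grid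
saturation, the knit's floor `(11d + 4ρ + Mc)·L + 3 ≤ ν.M₁`, `1 ≤ ρ`, `1 ≤ Mc`, level room `j + 1 ≤ m + K`, the token's ranges (`0 < δ_n ≤ a₁`, `δ_n ≤ 2δ_{n+1}`) and the guard
`(((d+2)L)²∕4)·((4(d−1)(2L−1)+1)·a₁) < δ_N`; data `W` with (7) for the support of record and a field `U` on the fibre; at every datum `(j, idx)`, `1 ≤ j ≤ k`, whose print box meets `Ω_j`
within `3` and is PRINT-MARGIN-CLEAN (`j = k ∨` the `2ρ`-widened print box misses `Ω_{j+1}`): every level-`j` plaquette of `M^j U` based in `□̃ = [tLo cornerP ρ, tHi cornerP sideP ρ]` is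
`< (1 + 2C_L)·δ_j`, `C_L = (L² + 6((d+2)L)²)·(4(d−1)(2L−1) + 1)`.
[cite: Balaban1985Variational, (7) p.278 L20–33, (13) p.280, (144) p.300, (147) p.301, (160) p.303; Balaban1985Averaging, Prop. 1 (51) pp.25–26; Balaban1984PropagatorsII, (2.3) p.224; Balaban1988Convergent, p.255, (2.2), (2.10)–(2.13) pp.255–257] -/
theorem plaqSmallOn_printWindow_iter_of_dataB {ν : Stage7Numerics} {M : ℕ} {g : ℕ → ℝ} {K k : ℕ} (s : SeqOfRecord F ν M g K k)
    (hsep : Sect2.SeqSeparated ν.M₁ s) (hkK : k ≤ (F.P K).m + (F.P K).K)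
    (hgrid : ∀ j : ℕ, 1 ≤ j → j ≤ k → dCubeSide (F.P K).L M (RkOfRecord (F.P K).L ν.r (g j)) j ∣ (F.P K).sitesPerDir 0)
    {Mc ρ : ℕ} (hMc : 1 ≤ Mc) (hρ : 1 ≤ ρ) (hfloor : (11 * (F.P K).d + 4 * ρ + Mc) * (F.P K).L + 3 ≤ ν.M₁)
    {δ : ℕ → ℝ} {a₁ : ℝ} (hδ : ∀ n, n ≤ k → 0 < δ n ∧ δ n ≤ a₁) (hcompδ : ∀ n, n < k → δ n ≤ 2 * δ (n + 1))
    (hguard : (((((F.P K).d + 2) * (F.P K).L : ℕ) : ℝ) ^ 2 / 4) * ((4 * (((((F.P K).d - 1 : ℕ) : ℝ)) * ((2 * (F.P K).L - 1 : ℕ) : ℝ)) + 1) * a₁) < deltaSU (Fin N))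
    (W : MSField (F.P K) (SU N)) (h7 : Sect2.DataSmall7LamTop (avOfRecord F N K) s.Ω (suppDomOfRecord F ν K s.Ω) k δ W)
    (U : GaugeField (F.P K) 0 (SU N)) (hfib : AgreeOnB (lamBondsSeq s.Ω k) (avgFamily (avOfRecord F N K) U) W)
    {j : ℕ} (hj1 : 1 ≤ j) (hjk : j ≤ k) (hjK : j + 1 ≤ (F.P K).m + (F.P K).K) (idx : Pt (F.P K).d)
    (hmeet : ∃ x ∈ box (F.P K).L (cornerP (F.P K) Mc ρ idx) (sideP (F.P K) Mc ρ) j, ∃ y : Pt (F.P K).d, cover (F.P K) y ∈ s.Ω j ∧ Within ((3 : ℕ) : ℤ) x y)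
    (hclean : j = k ∨ ∀ z ∈ box (F.P K).L (cornerP (F.P K) Mc ρ idx - ((2 * ρ : ℕ) : Pt (F.P K).d)) (sideP (F.P K) Mc ρ + 2 * (2 * ρ)) j, cover (F.P K) z ∉ s.Ω (j + 1)) :
    PlaqSmallOn (boxPlaqs (tLo (cornerP (F.P K) Mc ρ idx) ρ) (tHi (cornerP (F.P K) Mc ρ idx) (sideP (F.P K) Mc ρ) ρ))
      ((1 + 2 * ((((F.P K).L : ℝ) ^ 2 + 6 * ((((F.P K).d + 2) * (F.P K).L : ℕ) : ℝ) ^ 2) * (4 * (((((F.P K).d - 1 : ℕ) : ℝ)) * ((2 * (F.P K).L - 1 : ℕ) : ℝ)) + 1))) * δ j)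
      (Averaging.iter (avOfRecord F N K) j U) := by
  -- write `j = m + 1`
  obtain ⟨m, rfl⟩ : ∃ m, j = m + 1 := ⟨j - 1, by omega⟩
  set c : Pt (F.P K).d := cornerP (F.P K) Mc ρ idx with hc
  set S : ℕ := sideP (F.P K) Mc ρ with hS
  set CL : ℝ := (((F.P K).L : ℝ) ^ 2 + 6 * ((((F.P K).d + 2) * (F.P K).L : ℕ) : ℝ) ^ 2) * (4 * (((((F.P K).d - 1 : ℕ) : ℝ)) * ((2 * (F.P K).L - 1 : ℕ) : ℝ)) + 1) with hCL
  have hCL0 : 0 ≤ CL := by positivity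
  have hν0 : 0 < ν.M₁ := by omega
  have hν1 : 1 ≤ ν.M₁ := hν0
  have hρ0 : 0 < ρ := hρ
  have hS1 : 1 ≤ S := by have := le_sideP (P := F.P K) Mc hρ0; omega
  -- the letters of MODULE 69a: `δ₁ = δ_{m+1}`, `a = δ_m ≤ a₁`
  have hδm : 0 < δ m := (hδ m (by omega)).1
  have hδm1 : δ m ≤ a₁ := (hδ m (by omega)).2
  have hδj : 0 ≤ δ (m + 1) := (hδ (m + 1) hjk).1.le
  have hguard' : (((((F.P K).d + 2) * (F.P K).L : ℕ) : ℝ) ^ 2 / 4) * ((4 * (((((F.P K).d - 1 : ℕ) : ℝ)) * ((2 * (F.P K).L - 1 : ℕ) : ℝ)) + 1) * δ m) < deltaSU (Fin N) := by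
    refine lt_of_le_of_lt ?_ hguard
    gcongr
  have hN : 2 * (F.P K).L < (F.P K).sitesPerDir m := two_mul_L_lt_sitesPerDir (by omega)
  -- block saturation of `Ω_{m+1}` (grid numerics)
  have hsat : ∀ x x' : Site (F.P K) 0, iterBlockOf (m + 1) x = iterBlockOf (m + 1) x' → x ∈ s.Ω (m + 1) → x' ∈ s.Ω (m + 1) :=
    fun x x' => blockSat_seqOfRecord F ν M g K k hkK s hgrid (m + 1) x x' hj1 hjk
  -- the data's clauses
  have h7succ := h7.2 m hjk
  have h7m : ∀ m', m' + 1 = m → PlaqSmallOn (Sect2.lamPlaqs s.Ω k (m' + 1)) (δ m)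
      (Sect2.mixedFieldB (avOfRecord F N K) (lamBondsSeq s.Ω k (m' + 1)) (W (m' + 1)) (W m')) := by
    intro m' hm'
    subst hm'
    exact h7.2 m' (by omega)
  have h70 : m = 0 → PlaqSmallOn (Sect2.lamPlaqsTop s.Ω (suppDomOfRecord F ν K s.Ω) k) (δ m) (W 0) := by
    intro h0; subst h0; exact h7.1
  -- (i) MARGIN: the unit boxes of the `□̃` labels miss `Ω_{m+2}` (print-margin-clean; at the top `Ω_{k+1} = ∅`)
  have hfar : ∀ t ∈ Set.Icc (tLo c ρ) (tHi c S ρ),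
      ∀ z ∈ box (F.P K).L t 1 (m + 1), cover (F.P K) z ∉ s.Ω (m + 2) := by
    intro t ht z hz
    rcases hclean with htop | hcl
    · rw [s.Ω_off (m + 2) (by omega)]; exact Set.notMem_empty _
    · exact hcl z (unitBox_subset_printWindowBox c S ρ (m + 1) ht hz)
  -- (ii) COLLAR (`m ≥ 1`): every such point projects into `Ω_m` (within `2ρ·L^{m+1}` of the print box; 57a at `E = 2ρ`)
  obtain ⟨x₀, hx₀, y₀, hy₀, hxy₀⟩ := hmeet
  have hcol : 1 ≤ m → ∀ t ∈ Set.Icc (tLo c ρ) (tHi c S ρ),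
      ∀ z ∈ box (F.P K).L t 1 (m + 1), cover (F.P K) z ∈ s.Ω m := by
    intro h1 t ht z hz
    obtain ⟨y', hy', hzy'⟩ := exists_mem_box_within_of_mem_printWindowBox c hS1 ρ (m + 1) ht hz
    have hfl : 11 * (F.P K).d + 2 * ρ + Mc + 3 + 2 * ρ ≤ ν.M₁ := by
      have hL1 : 1 ≤ (F.P K).L := (F.P K).L_pos
      have : 11 * (F.P K).d + 4 * ρ + Mc ≤ (11 * (F.P K).d + 4 * ρ + Mc) * (F.P K).L := Nat.le_mul_of_pos_right _ hL1
      omega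
    have h := Sect2.cover_mem_Ω_pred_of_near_box_propCubeP_box (P := F.P K) hν1 s hsep (Dw := 3) (E := 2 * ρ) hfl (n := m + 1) (by omega) hjk hx₀ hy₀ hxy₀
      (z := z) (y' := y') hy' (by simpa [mul_comm, mul_assoc] using hzy')
    simpa using h
  -- (iii) SUPPORT (`m = 0`): every such point lies within `ν.M₁` of the meeting site, hence in `hullD ν.M₁ 1 (Ω 1)`
  have hsupp : m = 0 → ∀ t ∈ Set.Icc (tLo c ρ) (tHi c S ρ),
      ∀ z ∈ box (F.P K).L t 1 (m + 1), cover (F.P K) z ∈ suppDomOfRecord F ν K s.Ω := by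
    intro h0 t ht z hz
    subst h0
    obtain ⟨y', hy', hzy'⟩ := exists_mem_box_within_of_mem_printWindowBox c hS1 ρ (0 + 1) ht hz
    have hbox := within_of_mem_box_of_mem_box (F.P K).L hy' hx₀
    have hw := (hzy'.triangle hbox).triangle hxy₀
    rw [suppDomOfRecord_eq]
    refine cover_mem_hullD_one_of_within hν0 hy₀ (hw.mono ?_)
    have hSle : (S : ℤ) ≤ Mc + 11 * (F.P K).d + 2 * ρ := by exact_mod_cast sideP_le (P := F.P K) Mc ρ
    have hf : (((11 * (F.P K).d + 4 * ρ + Mc) * (F.P K).L + 3 : ℕ) : ℤ) ≤ ν.M₁ := by exact_mod_cast hfloor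
    push_cast at hf ⊢
    have hL0 : (0 : ℤ) ≤ (F.P K).L := by positivity
    nlinarith
  -- block saturation of `Ω_{m+2}` below the top (to read «off Ω_{m+2}» in F0a's block spelling)
  have hm2 : m + 1 < k → m + 1 + 1 ≤ (F.P K).m + (F.P K).K := fun h => by omega
  have hsat2 : m + 1 < k → ∀ x x' : Site (F.P K) 0, iterBlockOf (m + 1 + 1) x = iterBlockOf (m + 1 + 1) x' → x ∈ s.Ω (m + 1 + 1) → x' ∈ s.Ω (m + 1 + 1) :=
    fun h x x' => blockSat_seqOfRecord F ν M g K k hkK s hgrid (m + 1 + 1) x x' (by omega) (by omega)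
  -- MODULE 69a₂ᴮ, then `δ_m ≤ 2δ_{m+1}`
  have hmain := plaqSmallOn_boxPlaqs_iter_succB F N K s.Ω W U hjk (by omega) hfib hsat hm2 hsat2 hδj hδm hN hguard' h7succ h7m h70 hfar hcol hsupp
  intro p hp
  refine (hmain p hp).trans_le ?_
  have h2 : δ m ≤ 2 * δ (m + 1) := hcompδ m (by omega)
  have hAB : (((F.P K).L : ℝ) ^ 2 + 6 * ((((F.P K).d + 2) * (F.P K).L : ℕ) : ℝ) ^ 2) *
      ((4 * (((((F.P K).d - 1 : ℕ) : ℝ)) * ((2 * (F.P K).L - 1 : ℕ) : ℝ)) + 1) * δ m) = CL * δ m := by rw [hCL]; ring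
  rw [hAB]
  nlinarith [mul_le_mul_of_nonneg_left h2 hCL0]

end Record

end Summit.QuantumFields.YangMills.BalabanUVNodes.N07PrintWindowDataSmallB

end
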